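import Summits.Langlands.Langlands.Theses.DyadicOddResidue
import Literature.NumberTheory.Automorphic.CompletedCohomologyHeckeAlgebraGLn

/-!
# Sketch — crux-ideate stmt-Langlands-18745 (`DyadicOddResidue.SectorComplement`), round 1, ideator 2

First lemmas of the two idea cards, typed over existing declarations (no new axioms; `sorry`-free):

* §1 `RegularFern` (card `regular-fern-weight-one`): the cut of Fontaine–Mazur–Langlands on odd
  `GL₂/ℚ` into the route target `X = OddRegularReciprocityQ` (pairwise distinct labelled
  Hodge–Tate weights) and its IRREGULAR complement (a repeated weight = the weight-one sector),
  proved as pure logic; the two stubs of the lever as `Prop`s — `IrregularProModularity`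
  (X ⇒ pro-modularity of every odd irregular de Rham `ρ`: X is the modularity ORACLE for the
  regular de Rham seed point of Böckle–Allen density — finiteness of the global pseudo-deformation
  space over the local lifting space at `ℓ`, intersection with a regular potentially crystalline
  locus, smoothness of the X-modular seed by characteristic-zero adjoint-Selmer vanishing,
  Gouvêa–Mazur infinite fern, Carayol level bound) and `ProModularIrregularClassical` (Pan, Forum
  Math. Pi 10 (2022) Thm. 6.4.7, in the tree's `TameLevel.IsPadicallyAutomorphic` vocabulary) —
  and the kernel-checked composition `oddReciprocityQ_of_fern : (X → IrregularProModularity) →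
  ProModularIrregularClassical → X → OddReciprocityQ`.  (A naive ANALYTIC approximation —
  char-0 Ш-killing by auxiliary primes + lifting explicit local arcs — does NOT work: auxiliary
  primes are inert with `E`-coefficients and the global image in the local deformation space has
  codimension ≥ 1; recorded in the card's Dead lines.)
* §2 `ParityPin` (card `parity-pins-infinity-type`): over `ℚ` (one archimedean place) the
  a.e.-Satake sector theorem X upgrades to direction (B) of the summit VERBATIM on the sector —
  `Corresponds 𝓡 ι π ρ` at every finite place, for EVERY reciprocity datum `𝓡` — granted the
  parity pin of the infinity type and local–global compatibility for regular `π`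
  (`oddRegularCorrespondenceQ_of`).
-/

open scoped NumberField
open IsDedekindDomain Filter
open Literature.NumberTheory.Automorphic Literature.NumberTheory.GaloisRepresentations
open Summit.Langlands Summit.Langlands.Langlands.Theses.DyadicOddResidue

noncomputable section

set_option linter.dupNamespace false

namespace Summit.Langlands.Langlands.Cruxes.SectorComplement.RegularFern

variable {ℓ : ℕ} [Fact ℓ.Prime]

/-- `ρ` is de Rham at (every place above) `ℓ` for Fontaine's pinned datum — the summit's clause. -/
def DeRhamAbove (ρ : FramedGaloisRep ℚ (PadicAlgCl ℓ) 2) : Prop :=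
  ∀ (v : HeightOneSpectrum (𝓞 ℚ)) (hv : ((ℓ : ℕ) : 𝓞 ℚ) ∈ v.asIdeal),
    (Literature.NumberTheory.PAdicHodge.fontainePstAdicCompletion v ℓ hv).IsDeRhamFramed (ρ.toLocal v)

/-- HT-REGULAR: pairwise distinct labelled Hodge–Tate weights at every `v ∣ ℓ` and every
continuous label `τ` (the route target's regularity clause, verbatim). -/
def RegularAbove (ρ : FramedGaloisRep ℚ (PadicAlgCl ℓ) 2) : Prop :=
  ∀ (v : HeightOneSpectrum (𝓞 ℚ)) (hv : ((ℓ : ℕ) : 𝓞 ℚ) ∈ v.asIdeal)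
    (τ : v.adicCompletion ℚ →+* PadicAlgCl ℓ), Continuous τ →
    (ρ.labelledHodgeTateWeightsAt v
      (Literature.NumberTheory.PAdicHodge.fontainePstAdicCompletion v ℓ hv).algebra
      (Literature.NumberTheory.PAdicHodge.fontainePstAdicCompletion v ℓ hv).𝔅 τ).Nodup

/-- The conclusion of weak automorphy (leaf `B_w`): an L-algebraic cuspidal `π` on `GL₂(𝔸_ℚ)`
Satake–Frobenius compatible with `ρ` at almost all places, for every level witness and `ι`. -/
def WeakAutomorphyConcl (ρ : FramedGaloisRep ℚ (PadicAlgCl ℓ) 2) : Prop :=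
  ∀ (hcpt : isCompact_glFiniteIntegralLevel 2 ℚ) (ι : PadicAlgCl ℓ ≃+* ℂ),
    ∃ π : CuspidalAutomorphicRepData 2 ℚ hcpt, π.1.IsLAlgebraic ∧
      ∀ᶠ v : HeightOneSpectrum (𝓞 ℚ) in cofinite, SatakeFrobCompatibleAt ι π.1 ρ v

/-- `B_w` on ALL odd two-dimensional `ρ` over `ℚ` (no weight condition): the region a frame line
for `SectorComplement` should discharge from `X`. -/
def OddReciprocityQ : Prop :=
  ∀ (ℓ : ℕ) [Fact ℓ.Prime] (ρ : FramedGaloisRep ℚ (PadicAlgCl ℓ) 2),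
    ρ.toGaloisRep.IsIrreducible → ρ.IsOdd →
    (∀ᶠ v : HeightOneSpectrum (𝓞 ℚ) in cofinite, ρ.IsUnramifiedAt v) →
    DeRhamAbove ρ → WeakAutomorphyConcl ρ

/-- The IRREGULAR odd sector (= weight one: a repeated labelled Hodge–Tate weight; de Rham with
equal weights `(w,w)` ⟺ `ρ ⊗ ε^w` potentially unramified at `ℓ`). -/
def OddIrregularReciprocityQ : Prop :=
  ∀ (ℓ : ℕ) [Fact ℓ.Prime] (ρ : FramedGaloisRep ℚ (PadicAlgCl ℓ) 2),
    ρ.toGaloisRep.IsIrreducible → ρ.IsOdd →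
    (∀ᶠ v : HeightOneSpectrum (𝓞 ℚ) in cofinite, ρ.IsUnramifiedAt v) →
    DeRhamAbove ρ → ¬ RegularAbove ρ → WeakAutomorphyConcl ρ

/-- Readback of the route target `X` in the split vocabulary. [folklore] -/
theorem oddRegularReciprocityQ_iff :
    OddRegularReciprocityQ ↔
      ∀ (ℓ : ℕ) [Fact ℓ.Prime] (ρ : FramedGaloisRep ℚ (PadicAlgCl ℓ) 2),
        ρ.toGaloisRep.IsIrreducible → ρ.IsOdd →
        (∀ᶠ v : HeightOneSpectrum (𝓞 ℚ) in cofinite, ρ.IsUnramifiedAt v) →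
        DeRhamAbove ρ → RegularAbove ρ → WeakAutomorphyConcl ρ := by
  constructor
  · intro hX ℓ _ ρ hirr hodd hur hdR hreg hcpt ι
    exact hX ℓ ρ hirr hodd hur (fun v hv ↦ ⟨hdR v hv, hreg v hv⟩) hcpt ι
  · intro h ℓ _ ρ hirr hodd hur hloc hcpt ι
    exact h ℓ ρ hirr hodd hur (fun v hv ↦ (hloc v hv).1) (fun v hv ↦ (hloc v hv).2) hcpt ι

/-- THE CUT (pure logic): `X` and the irregular sector give `B_w` on every odd `ρ` over `ℚ`. -/
theorem oddReciprocityQ_of (hX : OddRegularReciprocityQ) (hI : OddIrregularReciprocityQ) :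
    OddReciprocityQ := by
  intro ℓ _ ρ hirr hodd hur hdR
  by_cases hreg : RegularAbove ρ
  · exact oddRegularReciprocityQ_iff.1 hX ℓ ρ hirr hodd hur hdR hreg
  · exact hI ℓ ρ hirr hodd hur hdR hreg

/-- Conversely both pieces are special cases of `OddReciprocityQ`. [folklore] -/
theorem oddReciprocityQ_iff :
    OddReciprocityQ ↔ OddRegularReciprocityQ ∧ OddIrregularReciprocityQ :=
  ⟨fun h ↦ ⟨oddRegularReciprocityQ_iff.2 fun ℓ _ ρ hirr hodd hur hdR _ ↦ h ℓ ρ hirr hodd hur hdR,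
    fun ℓ _ ρ hirr hodd hur hdR _ ↦ h ℓ ρ hirr hodd hur hdR⟩, fun h ↦ oddReciprocityQ_of h.1 h.2⟩

/-- STUB 1 of the lever — **fern transfer**: granted `X`, every odd irreducible a.e.-unramified
`ρ : Γ_ℚ → GL₂(ℚ̄_ℓ)`, de Rham at `ℓ` with a repeated weight, is `ℓ`-adically automorphic of SOME
tame level (eigensystem of the completed-cohomology Hecke algebra `𝕋(K^ℓ)`): the irreducible
component of the pseudo-deformation generic fibre through `ρ` contains an X-modular regular de
Rham SEED (finiteness over the local lifting ring + intersection with a regular potentially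
crystalline locus), the seed is smooth (characteristic-zero adjoint-Selmer vanishing), so the
Gouvêa–Mazur fern makes modular points of Carayol's tame level Zariski dense in the component,
which therefore lies in `Spec 𝕋`. -/
def IrregularProModularity : Prop :=
  ∀ (ℓ : ℕ) [Fact ℓ.Prime] (ρ : FramedGaloisRep ℚ (PadicAlgCl ℓ) 2),
    ρ.toGaloisRep.IsIrreducible → ρ.IsOdd →
    (∀ᶠ v : HeightOneSpectrum (𝓞 ℚ) in cofinite, ρ.IsUnramifiedAt v) →
    DeRhamAbove ρ → ¬ RegularAbove ρ →
    ∃ 𝒰 : BigHeckeGLn.TameLevel 2 ℚ ℓ, 𝒰.IsPadicallyAutomorphic ρ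

/-- STUB 2 — **Pan's weight-one classicality of pro-modular representations** (Pan, Forum Math.
Pi 10 (2022) e7, Thm. 6.4.7, any prime: pro-modular + irreducible + Hodge–Tate of weights `0,0`
⇒ classical of weight one), in the summit's output format. -/
def ProModularIrregularClassical : Prop :=
  ∀ (ℓ : ℕ) [Fact ℓ.Prime] (ρ : FramedGaloisRep ℚ (PadicAlgCl ℓ) 2),
    ρ.toGaloisRep.IsIrreducible → (∃ 𝒰 : BigHeckeGLn.TameLevel 2 ℚ ℓ, 𝒰.IsPadicallyAutomorphic ρ) →
    DeRhamAbove ρ → ¬ RegularAbove ρ → WeakAutomorphyConcl ρ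

/-- The irregular sector from the two stubs and `X` (kernel-checked shape of the line). -/
theorem oddIrregularReciprocityQ_of_fern (h₁ : OddRegularReciprocityQ → IrregularProModularity)
    (h₂ : ProModularIrregularClassical) (hX : OddRegularReciprocityQ) :
    OddIrregularReciprocityQ :=
  fun ℓ _ ρ hirr hodd hur hdR hreg ↦ h₂ ℓ ρ hirr (h₁ hX ℓ ρ hirr hodd hur hdR hreg) hdR hreg

/-- **First lemma of the card**: `X` + fern transfer + Pan's classicality ⇒ `B_w` on all odd
`GL₂/ℚ`. -/
theorem oddReciprocityQ_of_fern (h₁ : OddRegularReciprocityQ → IrregularProModularity)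
    (h₂ : ProModularIrregularClassical) (hX : OddRegularReciprocityQ) : OddReciprocityQ :=
  oddReciprocityQ_of hX (oddIrregularReciprocityQ_of_fern h₁ h₂ hX)

end Summit.Langlands.Langlands.Cruxes.SectorComplement.RegularFern

namespace Summit.Langlands.Langlands.Cruxes.SectorComplement.ParityPin

open Summit.Langlands.Langlands.Cruxes.SectorComplement.RegularFern

/-- Direction (B) of the summit VERBATIM on the odd HT-regular sector over `ℚ`: for EVERY
reciprocity datum `𝓡`, full `Corresponds` (a.e. Satake AND local–global compatibility at every
finite place). This is the part of `SectorComplement` that re-demands the route's own sector. -/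
def OddRegularCorrespondenceQ : Prop :=
  ∀ (𝓡 : ReciprocityData ℚ) (ℓ : ℕ) [Fact ℓ.Prime] (ι : PadicAlgCl ℓ ≃+* ℂ)
    (ρ : FramedGaloisRep ℚ (PadicAlgCl ℓ) 2),
    ρ.toGaloisRep.IsIrreducible → ρ.IsOdd → IsGeometricFramed 𝓡 ρ → RegularAbove ρ →
    ∀ hcpt : isCompact_glFiniteIntegralLevel 2 ℚ,
      ∃ π : CuspidalAutomorphicRepData 2 ℚ hcpt, π.1.IsLAlgebraic ∧ Corresponds 𝓡 ι π.1 ρ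

/-- `π` has a REGULAR infinity type (discrete series `D_k`, `k ≥ 2`, up to twist) — the L-side
analogue of Clozel-regularity (the tree's `IsRegularAlgebraic` is C-algebraic, hence empty for
L-algebraic `π` on `GL₂`). -/
def IsLRegular {hcpt : isCompact_glFiniteIntegralLevel 2 ℚ} (π : CuspidalAutomorphicRepData 2 ℚ hcpt) :
    Prop :=
  ∃ T : InfinityType ℚ 2, π.1.HasInfinityType T ∧ T.IsRegular

/-- STUB — **the parity pin** (specific to `F = ℚ`: ONE archimedean place): an L-algebraic
cuspidal `π` a.e.-Satake-compatible with an odd, irreducible, HT-regular de Rham `ρ` has a regular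
infinity type. Mechanism: the central character of `π` is pinned at all places by `det ρ`
(GL₁ reciprocity over `ℚ`, signs included), so the even Maass type `π(ε|·|^a, ε|·|^a)` is excluded
by `det ρ(c) = -1`; the weight-one type is excluded by Deligne–Serre + distinct HT weights;
`π(|·|^a ε₁, |·|^b ε₂)`, `a ≠ b`, by unitarity of cuspidal `π` up to twist. -/
def ParityPinsInfinityType : Prop :=
  ∀ (ℓ : ℕ) [Fact ℓ.Prime] (ι : PadicAlgCl ℓ ≃+* ℂ) (ρ : FramedGaloisRep ℚ (PadicAlgCl ℓ) 2)
    (hcpt : isCompact_glFiniteIntegralLevel 2 ℚ) (π : CuspidalAutomorphicRepData 2 ℚ hcpt),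
    ρ.toGaloisRep.IsIrreducible → ρ.IsOdd → DeRhamAbove ρ → RegularAbove ρ → π.1.IsLAlgebraic →
    (∀ᶠ v : HeightOneSpectrum (𝓞 ℚ) in cofinite, SatakeFrobCompatibleAt ι π.1 ρ v) → IsLRegular π

/-- STUB — **local–global compatibility for regular `π` on `GL₂/ℚ`, every place, every `𝓡`**
(Carayol 1986 at `v ∤ ℓ`; T. Saito 1997 at `v ∣ ℓ` through the pinned `D_pst`; strong
multiplicity one; Henniart's uniqueness of `rec_v` making `∀ 𝓡` free). -/
def RegularLocalGlobalQ : Prop :=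
  ∀ (𝓡 : ReciprocityData ℚ) (ℓ : ℕ) [Fact ℓ.Prime] (ι : PadicAlgCl ℓ ≃+* ℂ)
    (ρ : FramedGaloisRep ℚ (PadicAlgCl ℓ) 2) (hcpt : isCompact_glFiniteIntegralLevel 2 ℚ)
    (π : CuspidalAutomorphicRepData 2 ℚ hcpt),
    ρ.toGaloisRep.IsIrreducible → IsGeometricFramed 𝓡 ρ → π.1.IsLAlgebraic → IsLRegular π →
    (∀ᶠ v : HeightOneSpectrum (𝓞 ℚ) in cofinite, SatakeFrobCompatibleAt ι π.1 ρ v) →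
    Corresponds 𝓡 ι π.1 ρ

/-- **First lemma of the card**: `X` upgrades, inside the cone, to (B) verbatim on its sector for
every `𝓡`, granted the parity pin and regular LGC. The de Rham clause of `IsGeometricFramed 𝓡`
IS the pinned one (`ReciprocityData.pst` is definitionally `fontainePstAdicCompletion`). -/
theorem oddRegularCorrespondenceQ_of (hpin : ParityPinsInfinityType) (hlgc : RegularLocalGlobalQ)
    (hX : OddRegularReciprocityQ) : OddRegularCorrespondenceQ := by
  intro 𝓡 ℓ _ ι ρ hirr hodd hgeo hreg hcpt
  have hdR : DeRhamAbove ρ := fun v hv ↦ hgeo.2 v hv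
  obtain ⟨π, hLalg, hsat⟩ := oddRegularReciprocityQ_iff.1 hX ℓ ρ hirr hodd hgeo.1 hdR hreg hcpt ι
  exact ⟨π, hLalg, hlgc 𝓡 ℓ ι ρ hcpt π hirr hgeo hLalg
    (hpin ℓ ι ρ hcpt π hirr hodd hdR hreg hLalg hsat) hsat⟩

/-- What the frame item then still owes on the route's OWN sector is nil: under the two stubs,
`SectorComplement` is equivalent to the frame with the STRONGER antecedent (B)-verbatim. -/
theorem sectorComplement_iff_of (hpin : ParityPinsInfinityType) (hlgc : RegularLocalGlobalQ) :
    SectorComplement ↔ (OddRegularCorrespondenceQ → OddRegularReciprocityQ → _root_.Langlands) :=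
  ⟨fun hC _ hX ↦ hC hX, fun h hX ↦ h (oddRegularCorrespondenceQ_of hpin hlgc hX) hX⟩

end Summit.Langlands.Langlands.Cruxes.SectorComplement.ParityPin

end
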